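import Literature.AlgebraicGeometry.Resolution.AlterationsSemiStable
import Literature.AlgebraicGeometry.Resolution.AlterationsSemiStableResolution
import Literature.AlgebraicGeometry.Resolution.AlterationsSemiStableCodimTwo
import HarnessLib

/-!
# `WildQuotients.SummitReduction` (stmt-ResolutionOfSingularities-16324), line `FramePerfect`:
# the induction of de Jong 1996, Lemma 3.2 made `G`-equivariant (glue for stub `stub_pair_ssCodimThree`)

Route `ResolutionOfSingularities/WildQuotients`, crux `SummitReduction`; helper file of the line
skeleton `Cruxes/SummitReduction/Lines/FramePerfect.lean` (v6), stub A (`stub_pair_ssCodimThree` =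
de Jong 1996, Lemma 3.2 made `G`-equivariant and quasi-split, as in de Jong 1997, proof of
Prop. 5.11 ¶1: "`T ≅ Dᵢ` as `f` is quasi-split. As `D` is `G`-strict, `T' = ⋃ g(T)` is a disjoint
union … Thus we may assume that `X → S` is quasi-split semi-stable and `codim(Sing(X), X) ≥ 3`").

The printed proof of Lemma 3.2 ends: "Clearly, the lemma follows from the claim, by repeatedly
blowing up components of the singular locus of codimension 2 in `X` and induction on the numbers
`n_T`." The tree renders this induction, WITHOUT group, as
`DeJong1996Lemma32.of_singCodimTwo_of_codimTwoModification`; this file proves the SAME induction in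
the equivariant setting of de Jong 1997, 5.11, removing one `G`-ORBIT of codimension-2 components
at a time and carrying the `G`-action, the permuted sections and the boundary along:

* `eq_of_comp_eq_of_isIso_morphismRestrict`, `liftSection_equivariant` — the lifts
  (`DeJong1996.liftSection`, 4.24) of sections permuted by `G` through a `G`-equivariant `φ` which
  is an isomorphism near them are permuted by `G` in the same way;
* `pair_codimThree_of_finite_of_orbitModification` — **the equivariant induction**, for an
  ARBITRARY predicate `P f` on curves `f : X ⟶ Y` over the fixed `G`-base `(Y, D, ρ_Y)`: if `P f`
  makes the codimension-`≤ 2` singular points of `X` a finite set (3.4, parenthetical), and every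
  such point of an equivariant `P`-curve is removed, with its `G`-orbit and nothing else, by a
  `G`-equivariant modification `φ`, an isomorphism over the opens on which `f` is smooth, with
  `P (φ ≫ f)` (the Claim of 3.4 along the orbit `⋃ g(T)`, iterated `⌊n_T/2⌋` times), then every
  equivariant `P`-curve with `G`-permuted sections into the smooth locus admits a `G`-equivariant
  modification with lifted permuted sections, the same boundary, `P (φ ≫ f)`, and
  `codim(Sing X', X') ≥ 3`;
* `stub_pair_ssCodimThree_of_singCodimTwo_of_orbitModification` — stub A verbatim from the two
  sections-free statements (h0) `codim(Sing X, X) ≥ 2` and (h1) the equivariant orbit modification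
  preserving "projective, semi-stable, quasi-split, smooth off `D`" — the next layer of the stub.
-/

set_option linter.dupNamespace false

noncomputable section

open CategoryTheory CategoryTheory.Limits AlgebraicGeometry TopologicalSpace
open Literature.AlgebraicGeometry.Resolution
open Literature.AlgebraicGeometry

namespace Summit.ResolutionOfSingularities.ResolutionOfSingularities.Theorems

/-- If `φ : X' ⟶ X` restricts to an isomorphism over the open `U ⊆ X` and `a, b : Y ⟶ X'` satisfy
`a ≫ φ = b ≫ φ` with `b` (hence `a`) landing in `φ⁻¹(U)`, then `a = b`: both factor through the
open immersion `φ⁻¹(U) ↪ X'`, and `φ⁻¹(U) ≅ U ↪ X` is a monomorphism. [folklore] -/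
theorem eq_of_comp_eq_of_isIso_morphismRestrict {X' X Y : Scheme.{0}} (φ : X' ⟶ X) (U : X.Opens)
    [IsIso (φ ∣_ U)] {a b : Y ⟶ X'} (hab : a ≫ φ = b ≫ φ)
    (hb : Set.range b ⊆ ((φ ⁻¹ᵁ U : X'.Opens) : Set X')) : a = b := by
  have ha : Set.range a ⊆ ((φ ⁻¹ᵁ U : X'.Opens) : Set X') := by
    rintro _ ⟨y, rfl⟩
    have hy : φ (b y) ∈ U := hb ⟨y, rfl⟩
    show φ (a y) ∈ U
    rwa [← Scheme.Hom.comp_apply, ← hab, Scheme.Hom.comp_apply] at hy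
  have hιa : Set.range a ⊆ Set.range (φ ⁻¹ᵁ U).ι := by rwa [Scheme.Opens.range_ι]
  have hιb : Set.range b ⊆ Set.range (φ ⁻¹ᵁ U).ι := by rwa [Scheme.Opens.range_ι]
  rw [← IsOpenImmersion.lift_fac (φ ⁻¹ᵁ U).ι a hιa, ← IsOpenImmersion.lift_fac (φ ⁻¹ᵁ U).ι b hιb]
  congr 1
  haveI : Mono (φ ∣_ U ≫ U.ι) := mono_comp _ _
  rw [← cancel_mono (φ ∣_ U ≫ U.ι), morphismRestrict_ι, ← Category.assoc,
    IsOpenImmersion.lift_fac, ← Category.assoc, IsOpenImmersion.lift_fac, hab]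

/-- **Lifted sections are permuted as the sections are** (de Jong 1997, 5.11 (iii) upstairs):
if `φ : X' ⟶ X` is `G`-equivariant and an isomorphism over opens `Uᵢ ⊇ τᵢ(Y)`, and
`τᵢ ≫ ρ_X(g) = ρ_Y(g) ≫ τⱼ`, then the lifts `τ'ᵢ : Y ⟶ Uᵢ ≅ φ⁻¹(Uᵢ) ⊆ X'`
(`DeJong1996.liftSection`) satisfy `τ'ᵢ ≫ ρ_{X'}(g) = ρ_Y(g) ≫ τ'ⱼ`: both sides agree after `φ`
and the right-hand side lands in `φ⁻¹(Uⱼ)`. [cite: DeJong1997, Prop. 5.11, p. 618] -/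
theorem liftSection_equivariant {X' X Y : Scheme.{0}} (φ : X' ⟶ X) {G : Type} [Group G]
    (ρX' : G →* Aut X') (ρX : G →* Aut X) (ρY : G →* Aut Y)
    (hequiv : ∀ g : G, (ρX' g).hom ≫ φ = φ ≫ (ρX g).hom) {m : ℕ} (τ : Fin m → (Y ⟶ X))
    (U : Fin m → X.Opens) (hU : ∀ i, Set.range (τ i) ⊆ (U i : Set X)) [∀ i, IsIso (φ ∣_ U i)]
    (hτG : ∀ (g : G) (i : Fin m), ∃ j : Fin m, τ i ≫ (ρX g).hom = (ρY g).hom ≫ τ j) (g : G)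
    (i : Fin m) :
    ∃ j : Fin m, DeJong1996.liftSection (τ i) (U i) (hU i) φ ≫ (ρX' g).hom =
      (ρY g).hom ≫ DeJong1996.liftSection (τ j) (U j) (hU j) φ := by
  obtain ⟨j, hj⟩ := hτG g i
  refine ⟨j, eq_of_comp_eq_of_isIso_morphismRestrict φ (U j) ?_ ?_⟩
  · rw [Category.assoc, hequiv g, ← Category.assoc, DeJong1996.liftSection_comp, hj,
      Category.assoc, DeJong1996.liftSection_comp]
  · rintro _ ⟨y, rfl⟩
    rw [Scheme.Hom.comp_apply]
    exact DeJong1996.range_liftSection_subset _ _ _ _ ⟨_, rfl⟩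

/-! ## The equivariant induction of Lemma 3.2 -/

/-- The trivial case of the induction: if `X` has no codimension-`≤ 2` singular point, the
identity (with the same action and sections) is the required modification. [folklore] -/
theorem pair_codimThree_of_singularLocusCodimLE_eq_empty {Y : Scheme.{0}} (D : Set Y) {G : Type}
    [Group G] (ρY : G →* Aut Y) (P : ∀ ⦃X : Scheme.{0}⦄, (X ⟶ Y) → Prop) (X : Scheme.{0})
    [IsIntegral X] (f : X ⟶ Y) (ρX : G →* Aut X) (hP : P f) {m : ℕ} (τ : Fin m → (Y ⟶ X))
    (hτsm : ∀ i, ∃ U : X.Opens, Set.range (τ i) ⊆ (U : Set X) ∧ Smooth (U.ι ≫ f))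
    (hτG : ∀ (g : G) (i : Fin m), ∃ j : Fin m, τ i ≫ (ρX g).hom = (ρY g).hom ≫ τ j)
    (he : Scheme.singularLocusCodimLE X 2 = ∅) :
    ∃ (X' : Scheme.{0}) (_ : IsIntegral X') (φ : X' ⟶ X) (ρX' : G →* Aut X')
      (τ' : Fin m → (Y ⟶ X')),
      IsModification φ ∧ (∀ g : G, (ρX' g).hom ≫ φ = φ ≫ (ρX g).hom) ∧ (∀ i, τ' i ≫ φ = τ i) ∧
      φ.base ⁻¹' DeJong1996.semiStableBoundary f D τ =
        DeJong1996.semiStableBoundary (φ ≫ f) D τ' ∧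
      (∀ x : X', ¬ IsRegularLocalRing (X'.presheaf.stalk x) →
        (3 : WithBot ℕ∞) ≤ ringKrullDim (X'.presheaf.stalk x)) ∧
      P (φ ≫ f) ∧ (∀ U : X.Opens, Smooth (U.ι ≫ f) → IsIso (φ ∣_ U)) ∧
      (∀ i, ∃ U : X'.Opens, Set.range (τ' i) ⊆ (U : Set X') ∧ Smooth (U.ι ≫ φ ≫ f)) ∧
      (∀ (g : G) (i : Fin m), ∃ j : Fin m, τ' i ≫ (ρX' g).hom = (ρY g).hom ≫ τ' j) := by
  have hid : ∀ U : X.Opens, IsIso (𝟙 X ∣_ U) := fun U =>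
    (MorphismProperty.isomorphisms.iff _).mp
      (IsZariskiLocalAtTarget.restrict (P := MorphismProperty.isomorphisms Scheme)
        ((MorphismProperty.isomorphisms.iff _).mpr inferInstance) U)
  refine ⟨X, inferInstance, 𝟙 X, ρX, τ, ⟨inferInstance, inferInstance, ⊤, by simp, by simp, hid ⊤⟩,
    fun g => by simp, fun i => Category.comp_id _, ?_,
    (Scheme.singularLocusCodimLE_two_eq_empty_iff X).mp he, by simpa only [Category.id_comp] using hP,
    fun U _ => hid U, by simpa only [Category.id_comp] using hτsm, hτG⟩
  rw [Category.id_comp]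
  rfl

/-- **De Jong 1996, proof of Lemma 3.2, last sentence, made `G`-equivariant** (de Jong 1997,
proof of Prop. 5.11, first paragraph): "Clearly, the lemma follows from the claim, by repeatedly
blowing up components of the singular locus of codimension 2 in `X` and induction". Fix the base
`Y ⊇ D` with its `G`-action `ρ_Y` and a predicate `P` on curves `f : X ⟶ Y`. Assume (h0) the
codimension-`≤ 2` singular points of the total space of a `P`-curve form a finite set, and (h1)
for every `G`-equivariant `P`-curve `f : X ⟶ Y` and every codimension-`≤ 2` singular point `x`
of `X` there is a `G`-equivariant modification `φ : X' ⟶ X` (2.17), an isomorphism over every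
open of `X` on which `f` is smooth, with `P (φ ≫ f)`, mapping the codimension-`≤ 2` singular
points of `X'` injectively to those of `X` off the orbit `G · x`. Then every `G`-equivariant
`P`-curve with sections `τᵢ` into the smooth locus permuted by `G` admits such a modification
with lifted sections `τ'ᵢ ≫ φ = τᵢ` into the smooth locus of `φ ≫ f`, permuted alike, boundary
`φ⁻¹(⋃ᵢ τᵢ(Y) ∪ f⁻¹D) = ⋃ᵢ τ'ᵢ(Y) ∪ (φ ≫ f)⁻¹D`, `P (φ ≫ f)`, and `codim(Sing X', X') ≥ 3`.
Proof: induction on the number of codimension-`≤ 2` singular points; the sections lift through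
`φ` (4.24, `DeJong1996.liftSection`), equivariantly (`liftSection_equivariant`); modifications,
equivariance, boundaries and "isomorphism over the smooth opens" compose.
[cite: DeJong1996, 3.2–3.4 and 4.24, pp. 62–64, 75] [cite: DeJong1997, proof of Prop. 5.11, p. 618] -/
theorem pair_codimThree_of_finite_of_orbitModification {Y : Scheme.{0}} (D : Set Y) {G : Type}
    [Group G] (ρY : G →* Aut Y) (P : ∀ ⦃X : Scheme.{0}⦄, (X ⟶ Y) → Prop)
    (h0 : ∀ (X : Scheme.{0}) [IsIntegral X] (f : X ⟶ Y), P f → (Scheme.singularLocusCodimLE X 2).Finite)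
    (h1 : ∀ (X : Scheme.{0}) [IsIntegral X] (f : X ⟶ Y) (ρX : G →* Aut X), P f →
      (∀ g : G, (ρX g).hom ≫ f = f ≫ (ρY g).hom) →
      ∀ x ∈ Scheme.singularLocusCodimLE X 2,
        ∃ (X' : Scheme.{0}) (_ : IsIntegral X') (φ : X' ⟶ X) (ρX' : G →* Aut X'),
          IsModification φ ∧ (∀ g : G, (ρX' g).hom ≫ φ = φ ≫ (ρX g).hom) ∧ P (φ ≫ f) ∧
          (∀ U : X.Opens, Smooth (U.ι ≫ f) → IsIso (φ ∣_ U)) ∧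
          Set.MapsTo φ.base (Scheme.singularLocusCodimLE X' 2)
            (Scheme.singularLocusCodimLE X 2 \ Set.range fun g : G => (ρX g).hom.base x) ∧
          Set.InjOn φ.base (Scheme.singularLocusCodimLE X' 2))
    (X : Scheme.{0}) [IsIntegral X] (f : X ⟶ Y) (ρX : G →* Aut X) (hP : P f)
    (hρf : ∀ g : G, (ρX g).hom ≫ f = f ≫ (ρY g).hom) {m : ℕ} (τ : Fin m → (Y ⟶ X))
    (hτsm : ∀ i, ∃ U : X.Opens, Set.range (τ i) ⊆ (U : Set X) ∧ Smooth (U.ι ≫ f))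
    (hτG : ∀ (g : G) (i : Fin m), ∃ j : Fin m, τ i ≫ (ρX g).hom = (ρY g).hom ≫ τ j) :
    ∃ (X' : Scheme.{0}) (_ : IsIntegral X') (φ : X' ⟶ X) (ρX' : G →* Aut X')
      (τ' : Fin m → (Y ⟶ X')),
      IsModification φ ∧ (∀ g : G, (ρX' g).hom ≫ φ = φ ≫ (ρX g).hom) ∧ (∀ i, τ' i ≫ φ = τ i) ∧
      φ.base ⁻¹' DeJong1996.semiStableBoundary f D τ =
        DeJong1996.semiStableBoundary (φ ≫ f) D τ' ∧
      (∀ x : X', ¬ IsRegularLocalRing (X'.presheaf.stalk x) →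
        (3 : WithBot ℕ∞) ≤ ringKrullDim (X'.presheaf.stalk x)) ∧
      P (φ ≫ f) ∧ (∀ U : X.Opens, Smooth (U.ι ≫ f) → IsIso (φ ∣_ U)) ∧
      (∀ i, ∃ U : X'.Opens, Set.range (τ' i) ⊆ (U : Set X') ∧ Smooth (U.ι ≫ φ ≫ f)) ∧
      (∀ (g : G) (i : Fin m), ∃ j : Fin m, τ' i ≫ (ρX' g).hom = (ρY g).hom ≫ τ' j) := by
  -- induction on the number of codimension-2 singular points, over all curves on `(Y, D, ρ_Y)`
  suffices H : ∀ (n : ℕ) (X : Scheme.{0}) [IsIntegral X] (f : X ⟶ Y) (ρX : G →* Aut X), P f →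
      (∀ g : G, (ρX g).hom ≫ f = f ≫ (ρY g).hom) → ∀ (τ : Fin m → (Y ⟶ X)),
      (∀ i, ∃ U : X.Opens, Set.range (τ i) ⊆ (U : Set X) ∧ Smooth (U.ι ≫ f)) →
      (∀ (g : G) (i : Fin m), ∃ j : Fin m, τ i ≫ (ρX g).hom = (ρY g).hom ≫ τ j) →
      (Scheme.singularLocusCodimLE X 2).ncard ≤ n →
        ∃ (X' : Scheme.{0}) (_ : IsIntegral X') (φ : X' ⟶ X) (ρX' : G →* Aut X')
          (τ' : Fin m → (Y ⟶ X')),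
          IsModification φ ∧ (∀ g : G, (ρX' g).hom ≫ φ = φ ≫ (ρX g).hom) ∧
          (∀ i, τ' i ≫ φ = τ i) ∧
          φ.base ⁻¹' DeJong1996.semiStableBoundary f D τ =
            DeJong1996.semiStableBoundary (φ ≫ f) D τ' ∧
          (∀ x : X', ¬ IsRegularLocalRing (X'.presheaf.stalk x) →
            (3 : WithBot ℕ∞) ≤ ringKrullDim (X'.presheaf.stalk x)) ∧
          P (φ ≫ f) ∧ (∀ U : X.Opens, Smooth (U.ι ≫ f) → IsIso (φ ∣_ U)) ∧
          (∀ i, ∃ U : X'.Opens, Set.range (τ' i) ⊆ (U : Set X') ∧ Smooth (U.ι ≫ φ ≫ f)) ∧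
          (∀ (g : G) (i : Fin m), ∃ j : Fin m, τ' i ≫ (ρX' g).hom = (ρY g).hom ≫ τ' j) from
    H _ X f ρX hP hρf τ hτsm hτG le_rfl
  intro n
  induction n with
  | zero =>
    intro X _ f ρX hP hρf τ hτsm hτG hn
    exact pair_codimThree_of_singularLocusCodimLE_eq_empty D ρY P X f ρX hP τ hτsm hτG
      ((Set.ncard_eq_zero (h0 X f hP)).mp (Nat.le_zero.mp hn))
  | succ n ih =>
    intro X _ f ρX hP hρf τ hτsm hτG hn
    have hfin := h0 X f hP
    by_cases he : Scheme.singularLocusCodimLE X 2 = ∅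
    · exact pair_codimThree_of_singularLocusCodimLE_eq_empty D ρY P X f ρX hP τ hτsm hτG he
    -- remove the orbit of one codimension-2 singular point `x`
    obtain ⟨x, hx⟩ := Set.nonempty_iff_ne_empty.mpr he
    obtain ⟨X', hX', φ, ρX', hφ, hequiv, hP', hiso, hmaps, hinj⟩ := h1 X f ρX hP hρf x hx
    haveI := hX'
    -- 4.24: the sections lift, `φ` being an isomorphism over their smooth neighbourhoods
    choose U hU hUf using hτsm
    haveI : ∀ i, IsIso (φ ∣_ U i) := fun i => hiso (U i) (hUf i)
    set τ' : Fin m → (Y ⟶ X') := fun i => DeJong1996.liftSection (τ i) (U i) (hU i) φ with hτ'def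
    have hτ'φ : ∀ i, τ' i ≫ φ = τ i := fun i => DeJong1996.liftSection_comp _ _ _ _
    have hrange : ∀ i, Set.range (τ' i) = φ.base ⁻¹' Set.range (τ i) := fun i =>
      (DeJong1996.preimage_range_eq_range_liftSection (τ i) (U i) (hU i) φ).symm
    have hρf' : ∀ g : G, (ρX' g).hom ≫ φ ≫ f = (φ ≫ f) ≫ (ρY g).hom := fun g => by
      rw [← Category.assoc, hequiv g, Category.assoc, hρf g, Category.assoc]
    have hτ'sm : ∀ i, ∃ V : X'.Opens, Set.range (τ' i) ⊆ (V : Set X') ∧ Smooth (V.ι ≫ φ ≫ f) :=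
      fun i => ⟨φ ⁻¹ᵁ U i, DeJong1996.range_liftSection_subset _ _ _ _,
        DeJong1996.smooth_ι_comp_comp (U i) φ (hUf i)⟩
    have hτ'G : ∀ (g : G) (i : Fin m), ∃ j : Fin m, τ' i ≫ (ρX' g).hom = (ρY g).hom ≫ τ' j :=
      liftSection_equivariant φ ρX' ρX ρY hequiv τ U hU hτG
    have hZ' : φ.base ⁻¹' DeJong1996.semiStableBoundary f D τ =
        DeJong1996.semiStableBoundary (φ ≫ f) D τ' := by
      ext x'
      simp only [DeJong1996.mem_semiStableBoundary_iff, Set.mem_preimage, Scheme.Hom.comp_apply]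
      refine or_congr_left (exists_congr fun i => ?_)
      rw [hrange i, Set.mem_preimage]
    -- fewer codimension-2 singular points upstairs
    have hn' : (Scheme.singularLocusCodimLE X' 2).ncard ≤ n := by
      have h₁ := Set.ncard_le_ncard_of_injOn φ.base hmaps hinj (hfin.subset Set.sdiff_subset)
      have h₂ : (Scheme.singularLocusCodimLE X 2 \ Set.range fun g : G => (ρX g).hom.base x).ncard <
          (Scheme.singularLocusCodimLE X 2).ncard := by
        refine Set.ncard_lt_ncard ⟨Set.sdiff_subset, fun h => ?_⟩ hfin
        refine (h hx).2 ⟨1, ?_⟩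
        show (ρX 1).hom.base x = x
        rw [map_one]
        rfl
      omega
    -- induction upstairs, then compose (2.17)
    obtain ⟨X₁, hX₁, ψ, ρX₁, τ₁, hψ, hequiv₁, hτ₁ψ, hZ₁, hcodim, hP₁, hiso₁, hτ₁sm, hτ₁G⟩ :=
      ih X' (φ ≫ f) ρX' hP' hρf' τ' hτ'sm hτ'G hn'
    haveI := hX₁
    refine ⟨X₁, hX₁, ψ ≫ φ, ρX₁, τ₁, hψ.comp hφ, fun g => ?_, fun i => ?_, ?_, hcodim,
      by simpa only [Category.assoc] using hP₁, fun V hV => ?_,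
      by simpa only [Category.assoc] using hτ₁sm, hτ₁G⟩
    · rw [← Category.assoc, hequiv₁ g, Category.assoc, hequiv g, Category.assoc]
    · rw [← Category.assoc, hτ₁ψ i, hτ'φ i]
    · rw [Category.assoc, ← hZ₁, ← hZ']
      rfl
    · haveI hφV : IsIso (φ ∣_ V) := hiso V hV
      have hψV : IsIso (ψ ∣_ φ ⁻¹ᵁ V) := hiso₁ (φ ⁻¹ᵁ V) (DeJong1996.smooth_ι_comp_comp V φ hV)
      rw [morphismRestrict_comp]
      exact @IsIso.comp_isIso _ _ _ _ _ _ _ hψV hφV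

/-! ## The instance for the `G`-semi-stable pairs of the line -/

/-- **Stub A of the line from its two sections-free inputs** (the equivariant analogue of
`DeJong1996Lemma32.of_singCodimTwo_of_codimTwoModification` /
`DeJong1996SemiStableCodimThree.of_lemma32`): de Jong 1996, Lemma 3.2 made `G`-equivariant and
quasi-split — the conclusion of `stub_pair_ssCodimThree` verbatim — follows from
(h0) **3.4, parenthetical**: "`codim(Sing(X), X) ≥ 2`" for every integral projective `X` with a
semi-stable `f : X ⟶ Y` smooth over `Y ∖ D` (every non-regular local ring of `X` has dimension
`≥ 2`), and (h1) **3.3–3.4 along a `G`-orbit** (de Jong 1997, proof of 5.11, ¶1: "`T ≅ Dᵢ` as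
`f` is quasi-split. As `D` is `G`-strict, `T' = ⋃ g(T)` is a disjoint union", blown up
`⌊n_T/2⌋` times): for every `G`-equivariant projective quasi-split semi-stable `f : X ⟶ Y` smooth
over `Y ∖ D` and every non-regular `x ∈ X` with `dim 𝒪_{X,x} ≤ 2`, a `G`-equivariant
modification `φ : X' ⟶ X`, an isomorphism over the opens on which `f` is smooth, with `φ ≫ f`
again projective, semi-stable, quasi-split and smooth over `Y ∖ D`, mapping the
codimension-`≤ 2` singular points of `X'` injectively into those of `X` off the orbit of `x`.
Sections and boundary: `pair_codimThree_of_finite_of_orbitModification`; finiteness of the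
codimension-`≤ 2` singular points: (h0) and `Scheme.finite_singularLocusCodimLE_two`.
[cite: DeJong1996, 3.2–3.4 and 4.24, pp. 62–64, 75] [cite: DeJong1997, proof of Prop. 5.11, p. 618] -/
theorem stub_pair_ssCodimThree_of_singCodimTwo_of_orbitModification (k : Type) [Field k]
    (Y : Scheme.{0}) (q : Y ⟶ Spec (.of k)) (D : Set Y) (hD : IsStrictNormalCrossingsDivisor Y D)
    (G : Type) [Group G] (ρY : G →* Aut Y)
    (h0 : ∀ (X : Scheme.{0}) [IsIntegral X] (f : X ⟶ Y),
      Motives.IsProjectiveOver (Over.mk (f ≫ q)) → IsSemiStableCurve f →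
      Smooth (f ∣_ ⟨Dᶜ, hD.isClosed.isOpen_compl⟩) →
      ∀ x : X, ¬ IsRegularLocalRing (X.presheaf.stalk x) →
        (2 : WithBot ℕ∞) ≤ ringKrullDim (X.presheaf.stalk x))
    (h1 : ∀ (X : Scheme.{0}) [IsIntegral X] (f : X ⟶ Y) (ρX : G →* Aut X),
      Motives.IsProjectiveOver (Over.mk (f ≫ q)) →
      (∀ g : G, (ρX g).hom ≫ f = f ≫ (ρY g).hom) → IsSemiStableCurve f →
      (∀ x : X, (¬ ∃ U : X.Opens, x ∈ U ∧ Smooth (U.ι ≫ f)) →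
          ∃ e : AdicCompletion
              ((IsLocalRing.maximalIdeal (X.presheaf.stalk x)).map (Ideal.Quotient.mk
                ((IsLocalRing.maximalIdeal (Y.presheaf.stalk (f.base x))).map (f.stalkMap x).hom)))
              (X.presheaf.stalk x ⧸
                (IsLocalRing.maximalIdeal (Y.presheaf.stalk (f.base x))).map (f.stalkMap x).hom) ≃+*
            MvPowerSeries (Fin 2) (Y.presheaf.stalk (f.base x) ⧸ IsLocalRing.maximalIdeal (Y.presheaf.stalk (f.base x))) ⧸
              Ideal.span {(MvPowerSeries.X 0 * MvPowerSeries.X 1 :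
                MvPowerSeries (Fin 2) (Y.presheaf.stalk (f.base x) ⧸ IsLocalRing.maximalIdeal (Y.presheaf.stalk (f.base x))))},
            e.toRingHom.comp ((algebraMap (X.presheaf.stalk x ⧸
                (IsLocalRing.maximalIdeal (Y.presheaf.stalk (f.base x))).map (f.stalkMap x).hom) _).comp
              (Ideal.quotientMap ((IsLocalRing.maximalIdeal (Y.presheaf.stalk (f.base x))).map (f.stalkMap x).hom)
                (f.stalkMap x).hom Ideal.le_comap_map)) =
            algebraMap (Y.presheaf.stalk (f.base x) ⧸ IsLocalRing.maximalIdeal (Y.presheaf.stalk (f.base x))) _) →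
      Smooth (f ∣_ ⟨Dᶜ, hD.isClosed.isOpen_compl⟩) →
      ∀ x : X, ¬ IsRegularLocalRing (X.presheaf.stalk x) →
        ringKrullDim (X.presheaf.stalk x) ≤ 2 →
        ∃ (X' : Scheme.{0}) (_ : IsIntegral X') (φ : X' ⟶ X) (ρX' : G →* Aut X'),
          IsModification φ ∧ (∀ g : G, (ρX' g).hom ≫ φ = φ ≫ (ρX g).hom) ∧
          Motives.IsProjectiveOver (Over.mk ((φ ≫ f) ≫ q)) ∧
          (∀ U : X.Opens, Smooth (U.ι ≫ f) → IsIso (φ ∣_ U)) ∧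
          IsSemiStableCurve (φ ≫ f) ∧
          (∀ x : X', (¬ ∃ U : X'.Opens, x ∈ U ∧ Smooth (U.ι ≫ (φ ≫ f))) →
              ∃ e : AdicCompletion
                  ((IsLocalRing.maximalIdeal (X'.presheaf.stalk x)).map (Ideal.Quotient.mk
                    ((IsLocalRing.maximalIdeal (Y.presheaf.stalk ((φ ≫ f).base x))).map ((φ ≫ f).stalkMap x).hom)))
                  (X'.presheaf.stalk x ⧸
                    (IsLocalRing.maximalIdeal (Y.presheaf.stalk ((φ ≫ f).base x))).map ((φ ≫ f).stalkMap x).hom) ≃+*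
                MvPowerSeries (Fin 2) (Y.presheaf.stalk ((φ ≫ f).base x) ⧸ IsLocalRing.maximalIdeal (Y.presheaf.stalk ((φ ≫ f).base x))) ⧸
                  Ideal.span {(MvPowerSeries.X 0 * MvPowerSeries.X 1 :
                    MvPowerSeries (Fin 2) (Y.presheaf.stalk ((φ ≫ f).base x) ⧸ IsLocalRing.maximalIdeal (Y.presheaf.stalk ((φ ≫ f).base x))))},
                e.toRingHom.comp ((algebraMap (X'.presheaf.stalk x ⧸
                    (IsLocalRing.maximalIdeal (Y.presheaf.stalk ((φ ≫ f).base x))).map ((φ ≫ f).stalkMap x).hom) _).comp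
                  (Ideal.quotientMap ((IsLocalRing.maximalIdeal (Y.presheaf.stalk ((φ ≫ f).base x))).map ((φ ≫ f).stalkMap x).hom)
                    ((φ ≫ f).stalkMap x).hom Ideal.le_comap_map)) =
                algebraMap (Y.presheaf.stalk ((φ ≫ f).base x) ⧸ IsLocalRing.maximalIdeal (Y.presheaf.stalk ((φ ≫ f).base x))) _) ∧
          Smooth ((φ ≫ f) ∣_ ⟨Dᶜ, hD.isClosed.isOpen_compl⟩) ∧
          Set.MapsTo φ.base (Scheme.singularLocusCodimLE X' 2)
            (Scheme.singularLocusCodimLE X 2 \ Set.range fun g : G => (ρX g).hom.base x) ∧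
          Set.InjOn φ.base (Scheme.singularLocusCodimLE X' 2))
    (X : Scheme.{0}) [IsIntegral X] (f : X ⟶ Y)
    (hprojX : Motives.IsProjectiveOver (Over.mk (f ≫ q)))
    (ρX : G →* Aut X) (hρf : ∀ g : G, (ρX g).hom ≫ f = f ≫ (ρY g).hom)
    (hss : IsSemiStableCurve f)
    (hqs : (∀ x : X, (¬ ∃ U : X.Opens, x ∈ U ∧ Smooth (U.ι ≫ f)) →
        ∃ e : AdicCompletion
            ((IsLocalRing.maximalIdeal (X.presheaf.stalk x)).map (Ideal.Quotient.mk
              ((IsLocalRing.maximalIdeal (Y.presheaf.stalk (f.base x))).map (f.stalkMap x).hom)))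
            (X.presheaf.stalk x ⧸
              (IsLocalRing.maximalIdeal (Y.presheaf.stalk (f.base x))).map (f.stalkMap x).hom) ≃+*
          MvPowerSeries (Fin 2) (Y.presheaf.stalk (f.base x) ⧸ IsLocalRing.maximalIdeal (Y.presheaf.stalk (f.base x))) ⧸
            Ideal.span {(MvPowerSeries.X 0 * MvPowerSeries.X 1 :
              MvPowerSeries (Fin 2) (Y.presheaf.stalk (f.base x) ⧸ IsLocalRing.maximalIdeal (Y.presheaf.stalk (f.base x))))},
          e.toRingHom.comp ((algebraMap (X.presheaf.stalk x ⧸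
              (IsLocalRing.maximalIdeal (Y.presheaf.stalk (f.base x))).map (f.stalkMap x).hom) _).comp
            (Ideal.quotientMap ((IsLocalRing.maximalIdeal (Y.presheaf.stalk (f.base x))).map (f.stalkMap x).hom)
              (f.stalkMap x).hom Ideal.le_comap_map)) =
          algebraMap (Y.presheaf.stalk (f.base x) ⧸ IsLocalRing.maximalIdeal (Y.presheaf.stalk (f.base x))) _))
    (hsm : Smooth (f ∣_ ⟨Dᶜ, hD.isClosed.isOpen_compl⟩))
    (m : ℕ) (τ : Fin m → (Y ⟶ X))
    (hτsm : ∀ i : Fin m, ∃ U : X.Opens, Set.range (τ i) ⊆ (U : Set X) ∧ Smooth (U.ι ≫ f))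
    (hτG : ∀ (g : G) (i : Fin m), ∃ j : Fin m, τ i ≫ (ρX g).hom = (ρY g).hom ≫ τ j) :
    ∃ (X' : Scheme.{0}) (_ : IsIntegral X') (φ : X' ⟶ X) (ρX' : G →* Aut X')
          (τ' : Fin m → (Y ⟶ X')),
          IsModification φ ∧ (∀ g : G, (ρX' g).hom ≫ φ = φ ≫ (ρX g).hom) ∧ (∀ i : Fin m, τ' i ≫ φ = τ i) ∧
          φ.base ⁻¹' DeJong1996.semiStableBoundary f D τ = DeJong1996.semiStableBoundary (φ ≫ f) D τ' ∧
          (∀ x : X', ¬ IsRegularLocalRing (X'.presheaf.stalk x) →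
              (3 : WithBot ℕ∞) ≤ ringKrullDim (X'.presheaf.stalk x)) ∧
          Motives.IsProjectiveOver (Over.mk ((φ ≫ f) ≫ q)) ∧
          IsSemiStableCurve (φ ≫ f) ∧
          (∀ x : X', (¬ ∃ U : X'.Opens, x ∈ U ∧ Smooth (U.ι ≫ (φ ≫ f))) →
              ∃ e : AdicCompletion
                  ((IsLocalRing.maximalIdeal (X'.presheaf.stalk x)).map (Ideal.Quotient.mk
                    ((IsLocalRing.maximalIdeal (Y.presheaf.stalk ((φ ≫ f).base x))).map ((φ ≫ f).stalkMap x).hom)))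
                  (X'.presheaf.stalk x ⧸
                    (IsLocalRing.maximalIdeal (Y.presheaf.stalk ((φ ≫ f).base x))).map ((φ ≫ f).stalkMap x).hom) ≃+*
                MvPowerSeries (Fin 2) (Y.presheaf.stalk ((φ ≫ f).base x) ⧸ IsLocalRing.maximalIdeal (Y.presheaf.stalk ((φ ≫ f).base x))) ⧸
                  Ideal.span {(MvPowerSeries.X 0 * MvPowerSeries.X 1 :
                    MvPowerSeries (Fin 2) (Y.presheaf.stalk ((φ ≫ f).base x) ⧸ IsLocalRing.maximalIdeal (Y.presheaf.stalk ((φ ≫ f).base x))))},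
                e.toRingHom.comp ((algebraMap (X'.presheaf.stalk x ⧸
                    (IsLocalRing.maximalIdeal (Y.presheaf.stalk ((φ ≫ f).base x))).map ((φ ≫ f).stalkMap x).hom) _).comp
                  (Ideal.quotientMap ((IsLocalRing.maximalIdeal (Y.presheaf.stalk ((φ ≫ f).base x))).map ((φ ≫ f).stalkMap x).hom)
                    ((φ ≫ f).stalkMap x).hom Ideal.le_comap_map)) =
                algebraMap (Y.presheaf.stalk ((φ ≫ f).base x) ⧸ IsLocalRing.maximalIdeal (Y.presheaf.stalk ((φ ≫ f).base x))) _) ∧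
          Smooth ((φ ≫ f) ∣_ ⟨Dᶜ, hD.isClosed.isOpen_compl⟩) ∧
          (∀ i : Fin m, ∃ U : X'.Opens, Set.range (τ' i) ⊆ (U : Set X') ∧ Smooth (U.ι ≫ (φ ≫ f))) ∧
          (∀ (g : G) (i : Fin m), ∃ j : Fin m, τ' i ≫ (ρX' g).hom = (ρY g).hom ≫ τ' j) := by
  obtain ⟨X', hX', φ, ρX', τ', hφ, hequiv, hτ'φ, hZ, hcodim, ⟨hproj', hss', hqs', hsm'⟩, -, hτ'sm, hτ'G⟩ :=
    pair_codimThree_of_finite_of_orbitModification D ρY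
      (fun ⦃X : Scheme.{0}⦄ (f : X ⟶ Y) => Motives.IsProjectiveOver (Over.mk (f ≫ q)) ∧
        IsSemiStableCurve f ∧
        (∀ x : X, (¬ ∃ U : X.Opens, x ∈ U ∧ Smooth (U.ι ≫ f)) →
            ∃ e : AdicCompletion
                ((IsLocalRing.maximalIdeal (X.presheaf.stalk x)).map (Ideal.Quotient.mk
                  ((IsLocalRing.maximalIdeal (Y.presheaf.stalk (f.base x))).map (f.stalkMap x).hom)))
                (X.presheaf.stalk x ⧸
                  (IsLocalRing.maximalIdeal (Y.presheaf.stalk (f.base x))).map (f.stalkMap x).hom) ≃+*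
              MvPowerSeries (Fin 2) (Y.presheaf.stalk (f.base x) ⧸ IsLocalRing.maximalIdeal (Y.presheaf.stalk (f.base x))) ⧸
                Ideal.span {(MvPowerSeries.X 0 * MvPowerSeries.X 1 :
                  MvPowerSeries (Fin 2) (Y.presheaf.stalk (f.base x) ⧸ IsLocalRing.maximalIdeal (Y.presheaf.stalk (f.base x))))},
              e.toRingHom.comp ((algebraMap (X.presheaf.stalk x ⧸
                  (IsLocalRing.maximalIdeal (Y.presheaf.stalk (f.base x))).map (f.stalkMap x).hom) _).comp
                (Ideal.quotientMap ((IsLocalRing.maximalIdeal (Y.presheaf.stalk (f.base x))).map (f.stalkMap x).hom)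
                  (f.stalkMap x).hom Ideal.le_comap_map)) =
              algebraMap (Y.presheaf.stalk (f.base x) ⧸ IsLocalRing.maximalIdeal (Y.presheaf.stalk (f.base x))) _) ∧
        Smooth (f ∣_ ⟨Dᶜ, hD.isClosed.isOpen_compl⟩))
      (fun X _ f hPf => by
        obtain ⟨hproj, hss, -, hsm⟩ := hPf
        haveI := DeJong1996.isNoetherian_of_isProjectiveOver (f ≫ q) hproj
        haveI : IsProper (f ≫ q) := Motives.IsProjectiveOver.isProper (X := Over.mk (f ≫ q)) hproj
        exact Scheme.finite_singularLocusCodimLE_two (f ≫ q) (h0 X f hproj hss hsm))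
      (fun X _ f ρX hPf hρf x hx => by
        obtain ⟨hproj, hss, hqs, hsm⟩ := hPf
        obtain ⟨X', hX', φ, ρX', hφ, hequiv, hproj', hiso, hss', hqs', hsm', hmaps, hinj⟩ :=
          h1 X f ρX hproj hρf hss hqs hsm x hx.1 hx.2
        exact ⟨X', hX', φ, ρX', hφ, hequiv, ⟨hproj', hss', hqs', hsm'⟩, hiso, hmaps, hinj⟩)
      X f ρX (by exact ⟨hprojX, hss, hqs, hsm⟩) hρf τ hτsm hτG
  exact ⟨X', hX', φ, ρX', τ', hφ, hequiv, hτ'φ, hZ, hcodim, hproj', hss', hqs', hsm', hτ'sm, hτ'G⟩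

end Summit.ResolutionOfSingularities.ResolutionOfSingularities.Theorems

end
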